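import Literature.NumberTheory.QuadraticFields.ThreeTorsionMean
import Literature.NumberTheory.Sieve.SquarefreeProgressionsDensity
import HarnessLib

/-!
# Taniguchi–Thorne, Lemma 21: local factors and the `2`-adic splitting (proofs, part 1)

Bookkeeping for the proof of the named fact `tt_count_quadraticFields_progression`
(`ThreeTorsionMean.lean`; Taniguchi–Thorne, Duke Math. J. 162 (2013), Lemma 21
[cite: TaniguchiThorne2013, Lemma 21]), assembled in `ThreeTorsionMeanProofs.lean` from the
square-free count of `Sieve/SquarefreeProgressions*`:

* the Euler factors of the square-free density at `p ∣ q` are the printed `e(a, pᵏ)`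
  (`one_sub_gcdWeight_div_sq_eq_ttLocalFactorOdd`), so for `4 ∣ q`, `4 ∤ r` the density of
  square-free `n ≡ r (mod q)` is `(8/(π² q)) ∏_{p > 2, pᵏ ∥ q} e(r, pᵏ)(1 − p⁻²)⁻¹`
  (`tsum_density_eq_ttLocalFactors`);
* under `D ≡ a (mod m)`, `64 ∣ m`, the two kinds of fundamental discriminants — `D ≡ 1 (4)`
  square-free, and `D = 4d`, `d ≡ 2, 3 (4)` square-free — are selected by `a mod 16` alone, and the
  second kind is re-indexed by `d = D/4 ≡ a/4 (mod m/4)` (`card_typeOne`, `card_typeTwo`); both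
  signs are treated at once through `σ = ±1` (`card_filter_Ioo_neg` reflects `(-X, 0)` onto `(0, X)`).

No definitions are introduced.
-/

noncomputable section

open Finset ArithmeticFunction
open scoped ArithmeticFunction.Moebius

namespace Literature.NumberTheory.QuadraticFields

/-! ### The odd local factors are the Euler factors of the square-free density -/

/-- For a prime `p ∣ q`: `1 − [gcd(p², q) ∣ r] gcd(p², q)/p² = e(r, pᵏ)`, `k = v_p(q)` (the local
factor of `ttLocalFactorOdd`; at `p = 2` this reads `1 − [4 ∣ r]` when `4 ∣ q`).
[cite: TaniguchiThorne2013, Lemma 21] -/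
theorem one_sub_gcdWeight_div_sq_eq_ttLocalFactorOdd {q p : ℕ} (hq : q ≠ 0)
    (hp : p ∈ q.primeFactors) (r : ℤ) :
    1 - (if (((p ^ 2).gcd q : ℕ) : ℤ) ∣ r then (((p ^ 2).gcd q : ℕ) : ℝ) else 0) / (p : ℝ) ^ 2
      = ttLocalFactorOdd p (q.factorization p) r := by
  have hpp : p.Prime := Nat.prime_of_mem_primeFactors hp
  have hk : 1 ≤ q.factorization p :=
    Nat.Prime.factorization_pos_of_dvd hpp hq (Nat.dvd_of_mem_primeFactors hp)
  have hp0 : (p : ℝ) ≠ 0 := by exact_mod_cast hpp.ne_zero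
  rw [Sieve.sq_gcd_eq_pow_min hpp hq]
  unfold ttLocalFactorOdd
  rcases Nat.lt_or_ge (q.factorization p) 2 with hlt | hge
  · have hk1 : q.factorization p = 1 := by omega
    rw [hk1, show min 2 1 = 1 from rfl, pow_one]
    by_cases hpr : (p : ℤ) ∣ r
    · rw [if_pos hpr, if_neg (not_not.mpr hpr), if_neg (by omega), if_pos rfl]
      field_simp
    · rw [if_neg hpr, if_pos hpr]
      simp
  · rw [min_eq_left hge]
    have hk1 : q.factorization p ≠ 1 := by omega
    by_cases hpr : (p : ℤ) ∣ r
    · by_cases hp2r : (p : ℤ) ^ 2 ∣ r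
      · rw [if_pos (by exact_mod_cast hp2r), if_neg (not_not.mpr hpr), if_neg (fun h => h.2 hp2r),
          if_neg hk1]
        push_cast
        field_simp
        ring
      · rw [if_neg (by exact_mod_cast hp2r), if_neg (not_not.mpr hpr), if_pos ⟨hge, hp2r⟩]
        simp
    · have hp2r : ¬ (p : ℤ) ^ 2 ∣ r := fun h => hpr (dvd_trans ⟨p, by ring⟩ h)
      rw [if_neg (by exact_mod_cast hp2r), if_pos hpr]
      simp

/-- **The density of square-free `n ≡ r (mod q)` for `4 ∣ q`, `4 ∤ r`**:
`∑_d μ(d) [gcd(d², q) ∣ r]/lcm(d², q) = (8/(π² q)) ∏_{p > 2, p ∣ q} e(r, p^{v_p(q)}) (1 − p⁻²)⁻¹`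
(the factor at `2` is `1 · (1 − 1/4)⁻¹ = 4/3`). [cite: TaniguchiThorne2013, Lemma 21] -/
theorem tsum_density_eq_ttLocalFactors {q : ℕ} (hq : q ≠ 0) (h4 : 4 ∣ q) {r : ℤ}
    (hr : ¬ (4 : ℤ) ∣ r) :
    ∑' d : ℕ, (μ d : ℝ) *
        (if (((d ^ 2).gcd q : ℕ) : ℤ) ∣ r then 1 / (((d ^ 2).lcm q : ℕ) : ℝ) else 0)
      = 8 / (Real.pi ^ 2 * q) * ∏ p ∈ q.primeFactors.erase 2,
          ttLocalFactorOdd p (q.factorization p) r * (1 - 1 / (p : ℝ) ^ 2)⁻¹ := by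
  rw [Sieve.tsum_moebius_density_eq_prod (Nat.pos_of_ne_zero hq) r,
    Finset.prod_congr rfl fun p hp => by rw [one_sub_gcdWeight_div_sq_eq_ttLocalFactorOdd hq hp r]]
  have h2 : 2 ∈ q.primeFactors :=
    Nat.mem_primeFactors.mpr ⟨Nat.prime_two, dvd_trans ⟨2, rfl⟩ h4, hq⟩
  rw [← Finset.mul_prod_erase _ _ h2]
  have hv2 : 2 ≤ q.factorization 2 :=
    (Nat.Prime.pow_dvd_iff_le_factorization Nat.prime_two hq).mp (by simpa using h4)
  have htwo : ttLocalFactorOdd 2 (q.factorization 2) r = 1 := by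
    unfold ttLocalFactorOdd
    have h4' : ¬ ((2 : ℕ) : ℤ) ^ 2 ∣ r := by norm_num; exact hr
    by_cases h2r : ((2 : ℕ) : ℤ) ∣ r
    · rw [if_neg (not_not.mpr h2r), if_pos ⟨hv2, h4'⟩]
    · rw [if_pos h2r]
  rw [htwo]
  have hq0 : (q : ℝ) ≠ 0 := by exact_mod_cast hq
  push_cast
  field_simp
  ring

/-- For `p` an odd prime and `4 ∣ a`: `e(a/4, pᵏ) = e(a, pᵏ)`. [folklore] -/
theorem ttLocalFactorOdd_div_four {p : ℕ} (hp : p.Prime) (hp2 : p ≠ 2) (k : ℕ) {a : ℤ}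
    (ha : 4 ∣ a) : ttLocalFactorOdd p k (a / 4) = ttLocalFactorOdd p k a := by
  obtain ⟨a', rfl⟩ := ha
  have hcop : IsCoprime (p : ℤ) 4 := by
    have h : Nat.Coprime p 4 := by
      rw [Nat.Prime.coprime_iff_not_dvd hp]
      intro h
      exact hp2 ((Nat.prime_dvd_prime_iff_eq hp Nat.prime_two).mp
        (Nat.Prime.dvd_of_dvd_pow hp (show p ∣ 2 ^ 2 from h)))
    exact_mod_cast Nat.isCoprime_iff_coprime.mpr h
  have h1 : (p : ℤ) ∣ 4 * a' ↔ (p : ℤ) ∣ a' :=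
    ⟨fun h => hcop.dvd_of_dvd_mul_left h, fun h => dvd_mul_of_dvd_right h 4⟩
  have h2 : (p : ℤ) ^ 2 ∣ 4 * a' ↔ (p : ℤ) ^ 2 ∣ a' :=
    ⟨fun h => hcop.pow_left.dvd_of_dvd_mul_left h, fun h => dvd_mul_of_dvd_right h 4⟩
  rw [Int.mul_ediv_cancel_left _ (by norm_num : (4 : ℤ) ≠ 0)]
  simp only [ttLocalFactorOdd, h1, h2]

/-- `(m/4)` and `m` have the same odd prime factors (`4 ∣ m ≠ 0`). [folklore] -/
private theorem primeFactors_div_four_erase_two {m : ℕ} (hm0 : m ≠ 0) (hm : 4 ∣ m) :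
    (m / 4).primeFactors.erase 2 = m.primeFactors.erase 2 := by
  obtain ⟨m', rfl⟩ := hm
  have hm' : m' ≠ 0 := by rintro rfl; exact hm0 rfl
  rw [Nat.mul_div_cancel_left _ (by norm_num : 0 < 4), Nat.primeFactors_mul (by norm_num) hm',
    show (4 : ℕ) = 2 ^ 2 from rfl, Nat.primeFactors_prime_pow two_ne_zero Nat.prime_two]
  ext p
  simp only [mem_erase, mem_union, mem_singleton]
  tauto

/-- `v_p(m/4) = v_p(m)` for `p ≠ 2` (`4 ∣ m ≠ 0`). [folklore] -/
private theorem factorization_div_four {m : ℕ} (hm0 : m ≠ 0) (hm : 4 ∣ m) {p : ℕ} (hp : p ≠ 2) :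
    (m / 4).factorization p = m.factorization p := by
  obtain ⟨m', rfl⟩ := hm
  have hm' : m' ≠ 0 := by rintro rfl; exact hm0 rfl
  rw [Nat.mul_div_cancel_left _ (by norm_num : 0 < 4), Nat.factorization_mul (by norm_num) hm',
    Finsupp.add_apply, show (4 : ℕ) = 2 ^ 2 from rfl, Nat.prime_two.factorization_pow,
    Finsupp.single_apply, if_neg (Ne.symm hp), zero_add]

/-- The odd part of the density is unchanged under `(m, a) ↦ (m/4, a/4)` (`4 ∣ m`, `4 ∣ a`).
[folklore] -/
theorem prod_ttLocalFactorOdd_div_four {m : ℕ} (hm0 : m ≠ 0) (hm : 4 ∣ m) {a : ℤ} (ha : 4 ∣ a) :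
    ∏ p ∈ (m / 4).primeFactors.erase 2,
        ttLocalFactorOdd p ((m / 4).factorization p) (a / 4) * (1 - 1 / (p : ℝ) ^ 2)⁻¹
      = ∏ p ∈ m.primeFactors.erase 2,
        ttLocalFactorOdd p (m.factorization p) a * (1 - 1 / (p : ℝ) ^ 2)⁻¹ := by
  rw [primeFactors_div_four_erase_two hm0 hm]
  refine Finset.prod_congr rfl fun p hp => ?_
  have hp2 : p ≠ 2 := Finset.ne_of_mem_erase hp
  have hpp : p.Prime := Nat.prime_of_mem_primeFactors (Finset.mem_of_mem_erase hp)
  rw [factorization_div_four hm0 hm hp2, ttLocalFactorOdd_div_four hpp hp2 _ ha]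

/-! ### Signs, and the reflection `(-X, 0) → (0, X)` -/

/-- `Squarefree (σ k) ↔ Squarefree k` for `σ = ±1`. [folklore] -/
private theorem squarefree_sign_mul_iff {σ : ℤ} (hσ : σ = 1 ∨ σ = -1) (k : ℤ) :
    Squarefree (σ * k) ↔ Squarefree k := by
  rcases hσ with rfl | rfl
  · rw [one_mul]
  · rw [neg_one_mul, ← Int.squarefree_natAbs, Int.natAbs_neg, Int.squarefree_natAbs]

/-- `4 ∣ σ n ↔ 4 ∣ n` for `σ = ±1`. [folklore] -/
private theorem four_dvd_sign_mul_iff {σ : ℤ} (hσ : σ = 1 ∨ σ = -1) (n : ℤ) :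
    (4 : ℤ) ∣ σ * n ↔ 4 ∣ n := by
  rcases hσ with rfl | rfl
  · rw [one_mul]
  · rw [neg_one_mul, dvd_neg]

/-- `#{D ∈ (-X, 0) : P D} = #{n ∈ (0, X) : P(-n)}`. [folklore] -/
theorem card_filter_Ioo_neg (X : ℕ) (P : ℤ → Prop) [DecidablePred P] :
    #{D ∈ Ioo (-(X : ℤ)) 0 | P D} = #{n ∈ Ioo (0 : ℤ) X | P (-n)} := by
  refine Finset.card_nbij' (fun D => -D) (fun n => -n) ?_ ?_ (fun D _ => neg_neg D)
    (fun n _ => neg_neg n)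
  · intro D hD
    simp only [Finset.mem_coe, mem_filter, mem_Ioo, neg_neg] at hD ⊢
    exact ⟨⟨by omega, by omega⟩, hD.2⟩
  · intro n hn
    simp only [Finset.mem_coe, mem_filter, mem_Ioo] at hn ⊢
    exact ⟨⟨by omega, by omega⟩, hn.2⟩

/-! ### Under `D ≡ a (mod m)`, `4 ∣ m`: the kind of `D` is read off `a` -/

/-- `x ≡ a (mod m) ↔ x/4 ≡ a/4 (mod m/4)` when `4` divides `x`, `a` and `m`. [folklore] -/
private theorem modEq_iff_ediv_four_modEq {x a : ℤ} {m : ℕ} (hx : 4 ∣ x) (ha : 4 ∣ a) (hm : 4 ∣ m) :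
    x ≡ a [ZMOD m] ↔ x / 4 ≡ a / 4 [ZMOD ((m / 4 : ℕ) : ℤ)] := by
  obtain ⟨x', rfl⟩ := hx
  obtain ⟨a', rfl⟩ := ha
  obtain ⟨m', rfl⟩ := hm
  rw [Nat.mul_div_cancel_left _ (by norm_num : 0 < 4),
    Int.mul_ediv_cancel_left _ (by norm_num : (4 : ℤ) ≠ 0),
    Int.mul_ediv_cancel_left _ (by norm_num : (4 : ℤ) ≠ 0), Int.modEq_iff_dvd, Int.modEq_iff_dvd,
    Nat.cast_mul, Nat.cast_ofNat, ← mul_sub, mul_dvd_mul_iff_left (by norm_num : (4 : ℤ) ≠ 0)]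

/-- **First kind** (`D ≡ 1 (mod 4)` square-free, `D ≠ 1`), for `D = σ n`, `0 < n ≤ N`,
`D ≡ a (mod m)`, `4 ∣ m`: empty unless `a ≡ 1 (mod 4)`, and then it is the square-free `n` with
`σ n ≡ a (mod m)`, `σ n ≠ 1`. [cite: TaniguchiThorne2013, Lemma 21] -/
theorem card_typeOne {σ : ℤ} (hσ : σ = 1 ∨ σ = -1) {m : ℕ} (hm4 : 4 ∣ m) (a : ℤ) (N : ℕ) :
    #{n ∈ Ioc (0 : ℤ) N | (σ * n % 4 = 1 ∧ Squarefree (σ * n) ∧ σ * n ≠ 1) ∧ σ * n ≡ a [ZMOD m]}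
      = if a % 4 = 1 then
          #{n ∈ Ioc (0 : ℤ) N | (σ * n ≡ a [ZMOD m] ∧ Squarefree n) ∧ σ * n ≠ 1} else 0 := by
  have hm4' : (4 : ℤ) ∣ (m : ℤ) := by exact_mod_cast hm4
  have hiff : ∀ n ∈ Ioc (0 : ℤ) N,
      ((σ * n % 4 = 1 ∧ Squarefree (σ * n) ∧ σ * n ≠ 1) ∧ σ * n ≡ a [ZMOD m]) ↔
        a % 4 = 1 ∧ ((σ * n ≡ a [ZMOD m] ∧ Squarefree n) ∧ σ * n ≠ 1) := by
    intro n _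
    rw [squarefree_sign_mul_iff hσ]
    constructor
    · rintro ⟨⟨h1, hsq, hne⟩, hE⟩
      have h4 : σ * n % 4 = a % 4 := hE.of_dvd hm4'
      exact ⟨h4.symm.trans h1, ⟨hE, hsq⟩, hne⟩
    · rintro ⟨ha, ⟨hE, hsq⟩, hne⟩
      have h4 : σ * n % 4 = a % 4 := hE.of_dvd hm4'
      exact ⟨⟨h4.trans ha, hsq, hne⟩, hE⟩
  rw [Finset.filter_congr hiff]
  split_ifs with ha
  · simp only [ha, true_and]
  · simp [ha]

/-- Removing the single point `σ n = 1` costs at most `1`. [folklore] -/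
theorem abs_card_typeOne_sub_card_le {σ : ℤ} (hσ : σ = 1 ∨ σ = -1) (m : ℕ) (a : ℤ) (N : ℕ) :
    |(#{n ∈ Ioc (0 : ℤ) N | (σ * n ≡ a [ZMOD m] ∧ Squarefree n) ∧ σ * n ≠ 1} : ℝ)
      - #{n ∈ Ioc (0 : ℤ) N | σ * n ≡ a [ZMOD m] ∧ Squarefree n}| ≤ 1 := by
  set s := {n ∈ Ioc (0 : ℤ) N | σ * n ≡ a [ZMOD m] ∧ Squarefree n} with hs
  have hsplit := Finset.card_filter_add_card_filter_not (s := s) (fun n : ℤ => σ * n ≠ 1)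
  have h1 : s.filter (fun n : ℤ => σ * n ≠ 1)
      = {n ∈ Ioc (0 : ℤ) N | (σ * n ≡ a [ZMOD m] ∧ Squarefree n) ∧ σ * n ≠ 1} := by
    rw [hs, Finset.filter_filter]
  have h2 : #(s.filter (fun n : ℤ => ¬ (σ * n ≠ 1))) ≤ 1 := by
    refine Finset.card_le_one.mpr fun x hx y hy => ?_
    simp only [mem_filter, not_not] at hx hy
    rcases hσ with rfl | rfl <;> omega
  rw [h1] at hsplit
  have hsum : (#{n ∈ Ioc (0 : ℤ) N | (σ * n ≡ a [ZMOD m] ∧ Squarefree n) ∧ σ * n ≠ 1} : ℝ)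
      + #(s.filter (fun n : ℤ => ¬ (σ * n ≠ 1))) = #s := by
    exact_mod_cast hsplit
  have hB0 : (0 : ℝ) ≤ #(s.filter (fun n : ℤ => ¬ (σ * n ≠ 1))) := by positivity
  have hB1 : (#(s.filter (fun n : ℤ => ¬ (σ * n ≠ 1))) : ℝ) ≤ 1 := by exact_mod_cast h2
  rw [abs_le]
  constructor <;> linarith

/-- **Second kind** (`D = 4d`, `d ≡ 2, 3 (mod 4)` square-free), pointwise: for `D = σ n`,
`4 ∣ m`, `4 ∣ m/4`, the conditions "`D` of the second kind and `D ≡ a (mod m)`" say exactly that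
`a ≡ 8, 12 (mod 16)`, `4 ∣ n`, and `d = n/4` is square-free with `σ d ≡ a/4 (mod m/4)`.
[cite: TaniguchiThorne2013, Lemma 21] -/
theorem typeTwo_iff {σ : ℤ} (hσ : σ = 1 ∨ σ = -1) {m : ℕ} (hm4 : 4 ∣ m) (hm16 : 4 ∣ m / 4)
    (a n : ℤ) :
    ((4 ∣ σ * n ∧ (σ * n / 4 % 4 = 2 ∨ σ * n / 4 % 4 = 3) ∧ Squarefree (σ * n / 4)) ∧
        σ * n ≡ a [ZMOD m]) ↔
      (4 ∣ a ∧ (a / 4 % 4 = 2 ∨ a / 4 % 4 = 3)) ∧ 4 ∣ n ∧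
        (σ * (n / 4) ≡ a / 4 [ZMOD ((m / 4 : ℕ) : ℤ)] ∧ Squarefree (n / 4)) := by
  have hm4' : (4 : ℤ) ∣ (m : ℤ) := by exact_mod_cast hm4
  have hm16' : (4 : ℤ) ∣ ((m / 4 : ℕ) : ℤ) := by exact_mod_cast hm16
  constructor
  · rintro ⟨⟨h4, h23, hsq⟩, hE⟩
    have hn4 : (4 : ℤ) ∣ n := (four_dvd_sign_mul_iff hσ n).mp h4
    have ha4 : (4 : ℤ) ∣ a := (hE.of_dvd hm4').dvd_iff.mp h4
    have hE' := (modEq_iff_ediv_four_modEq h4 ha4 hm4).mp hE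
    rw [Int.mul_ediv_assoc σ hn4] at hE' hsq h23
    refine ⟨⟨ha4, ?_⟩, hn4, hE', (squarefree_sign_mul_iff hσ _).mp hsq⟩
    have hmod : σ * (n / 4) % 4 = a / 4 % 4 := hE'.of_dvd hm16'
    rwa [hmod] at h23
  · rintro ⟨⟨ha4, ha23⟩, hn4, hE', hsq⟩
    have h4 : (4 : ℤ) ∣ σ * n := (four_dvd_sign_mul_iff hσ n).mpr hn4
    have hE : σ * n ≡ a [ZMOD m] := by
      rw [modEq_iff_ediv_four_modEq h4 ha4 hm4, Int.mul_ediv_assoc σ hn4]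
      exact hE'
    refine ⟨⟨h4, ?_, ?_⟩, hE⟩
    · rw [Int.mul_ediv_assoc σ hn4]
      have hmod : σ * (n / 4) % 4 = a / 4 % 4 := hE'.of_dvd hm16'
      rwa [← hmod] at ha23
    · rw [Int.mul_ediv_assoc σ hn4]
      exact (squarefree_sign_mul_iff hσ _).mpr hsq

/-- **Second kind**, counted: empty unless `a ≡ 8, 12 (mod 16)`, and then re-indexed by
`d = n/4`, `0 < d ≤ N/4`. [cite: TaniguchiThorne2013, Lemma 21] -/
theorem card_typeTwo {σ : ℤ} (hσ : σ = 1 ∨ σ = -1) {m : ℕ} (hm4 : 4 ∣ m) (hm16 : 4 ∣ m / 4)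
    (a : ℤ) (N : ℕ) :
    #{n ∈ Ioc (0 : ℤ) N | (4 ∣ σ * n ∧ (σ * n / 4 % 4 = 2 ∨ σ * n / 4 % 4 = 3) ∧
        Squarefree (σ * n / 4)) ∧ σ * n ≡ a [ZMOD m]}
      = if 4 ∣ a ∧ (a / 4 % 4 = 2 ∨ a / 4 % 4 = 3) then
          #{k ∈ Ioc (0 : ℤ) (N / 4 : ℕ) | σ * k ≡ a / 4 [ZMOD ((m / 4 : ℕ) : ℤ)] ∧ Squarefree k}
        else 0 := by
  rw [Finset.filter_congr fun n _ => typeTwo_iff hσ hm4 hm16 a n]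
  split_ifs with hc
  · simp only [hc, true_and]
    have hset : {n ∈ Ioc (0 : ℤ) N | 4 ∣ n ∧
        (σ * (n / 4) ≡ a / 4 [ZMOD ((m / 4 : ℕ) : ℤ)] ∧ Squarefree (n / 4))}
        = ({k ∈ Ioc (0 : ℤ) (N / 4 : ℕ) |
            σ * k ≡ a / 4 [ZMOD ((m / 4 : ℕ) : ℤ)] ∧ Squarefree k}).map
            ⟨fun k => 4 * k, mul_right_injective₀ (by norm_num : (4 : ℤ) ≠ 0)⟩ := by
      ext n
      simp only [mem_filter, mem_Ioc, mem_map, Function.Embedding.coeFn_mk]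
      constructor
      · rintro ⟨⟨hn0, hnN⟩, ⟨k, rfl⟩, hQ⟩
        rw [Int.mul_ediv_cancel_left _ (by norm_num : (4 : ℤ) ≠ 0)] at hQ
        refine ⟨k, ⟨⟨by omega, ?_⟩, hQ⟩, rfl⟩
        push_cast
        omega
      · rintro ⟨k, ⟨⟨hk0, hkN⟩, hQ⟩, rfl⟩
        rw [Int.mul_ediv_cancel_left _ (by norm_num : (4 : ℤ) ≠ 0)]
        push_cast at hkN
        exact ⟨⟨by omega, by omega⟩, ⟨k, rfl⟩, hQ⟩
    rw [hset, card_map]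
  · simp [hc]

end Literature.NumberTheory.QuadraticFields

end
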